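import Mathlib
import Summits.ValiantsHypothesis.ValiantsHypothesis.Theses.LiouvilleSarnak
import Literature.Computability.AlgebraicComplexity.ValiantConjectureEquivProofs
import Literature.Computability.AlgebraicComplexity.ValiantClassesProofs
import Literature.Computability.AlgebraicComplexity.DepthReduction
import Literature.Computability.AlgebraicComplexity.CircuitDepth
import Literature.NumberTheory.Sieve.PretentiousDistance
import Literature.NumberTheory.LFunctions.LiouvilleNonpretentious

/-!
# Census sketch — crux `LiouvilleNotInVP` (stmt-ValiantsHypothesis-14772), route `LiouvilleSarnak`

Typed material for `STRATEGY-CENSUS.md` (crux-strategist, RESTATED re-audit, BC2-redirect test) of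
X := `LiouvilleNotInVP` (the Liouville family Λ, Λ_m = Σ_{e ∈ {0,1}^m} λ(1 + bin e) x^e, is not in
`VP ℂ`).  Sorry-free.  Contents:

* §0  Λ_m and its coefficient bookkeeping (cube coefficients `= λ(1 + bin e)`, support `⊆` cube,
      `Σ_supp ‖coeff‖² ≤ 2^m`, self-correlation `= 2^m`, `deg Λ_m ≤ m`, Λ is a p-family).
* §1  The candidate PIECES of the census, as `Prop`s (E1, D0–D12 of the census table).
* §2  DEMOS — the violations that are theorems: `X_of_algebraicSarnak` (the engine alone gives X:
      E1 is a strengthening, not a split), `hardIO_iff_X` / `X_of_hardAE` / `X_of_notInVQP` /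
      `X_of_depthFourHard` / `X_of_formulaQPHard_of_vsbr` (single pieces ≥ X), `perHard_iff_S`
      (landed iff with the summit) with the one-line seam `X_of_perHard_of_proj`, the one-line
      seam `X_of_collapse`, and `algebraicSarnak_of_pretentiousTransfer` (the un-tailored inverse
      theorem plus the PROVED `isNonpretentious_liouville_holds` already gives the engine).

References: Bürgisser 2000 (Def. 2.1–2.6, 2.26; Rem. 2.11; Thm. 2.10) [cite: Burgisser2000];
Tavenas 2015 Thm. 1 [cite: Tavenas2015]; Matomäki–Radziwiłł–Tao 2015 (1.12) [cite: Tao2015].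
-/

set_option linter.dupNamespace false
set_option linter.unusedVariables false

noncomputable section

namespace Summit.ValiantsHypothesis.ValiantsHypothesis.Cruxes.LiouvilleNotInVP.Census

open MvPolynomial Literature.Computability.AlgebraicComplexity
open Summit.ValiantsHypothesis.ValiantsHypothesis.Theses.LiouvilleSarnak

/-! ## §0 The Liouville polynomials -/

/-- The exponent vector of the cube point `e` (literally the term used in the route file). -/
abbrev ind {m : ℕ} (e : Fin m → Bool) : Fin m →₀ ℕ :=
  Finsupp.equivFunOnFinite.symm fun i => (e i).toNat

/-- The coefficient `λ(1 + bin e)` as a complex number (literally the term of the route file). -/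
abbrev lam {m : ℕ} (e : Fin m → Bool) : ℂ :=
  ((ArithmeticFunction.liouville (Nat.ofBits e + 1) : ℤ) : ℂ)

/-- `Λ_m`, literally the `poly` field of the family in `LiouvilleNotInVP`. -/
def liouvillePoly (m : ℕ) : MvPolynomial (Fin m) ℂ :=
  ∑ e : Fin m → Bool, C (lam e) * ∏ i : Fin m, (if e i then X i else 1)

/-- The bundled Liouville family (n variables at level n). -/
def liouvilleFamily : PolyFamily ℂ := ⟨fun n => n, fun n => liouvillePoly n⟩

/-- X is literally `liouvilleFamily ∉ VP ℂ`. -/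
theorem liouvilleNotInVP_iff : LiouvilleNotInVP ↔ liouvilleFamily ∉ VP ℂ := Iff.rfl

theorem ind_apply {m : ℕ} (e : Fin m → Bool) (i : Fin m) : ind e i = (e i).toNat := by
  simp [ind]

theorem ind_injective (m : ℕ) : Function.Injective (ind (m := m)) := by
  intro e e' h
  funext i
  have hi := congrArg (fun f : Fin m →₀ ℕ => f i) h
  simp only [ind_apply] at hi
  revert hi
  cases e i <;> cases e' i <;> simp

theorem prod_ite_eq_monomial {m : ℕ} (e : Fin m → Bool) :
    (∏ i : Fin m, (if e i then X i else (1 : MvPolynomial (Fin m) ℂ))) = monomial (ind e) 1 := by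
  rw [monomial_eq, C_1, one_mul, Finsupp.prod_fintype _ _ (fun i => pow_zero _)]
  refine Finset.prod_congr rfl fun i _ => ?_
  rw [ind_apply]
  cases e i <;> simp

theorem lam_mul_self {m : ℕ} (e : Fin m → Bool) : lam e * lam e = 1 := by
  simp only [lam]
  rw [← Int.cast_mul, ArithmeticFunction.liouville_apply (Nat.succ_ne_zero _), ← pow_add,
    ← two_mul, pow_mul]
  simp

theorem norm_lam {m : ℕ} (e : Fin m → Bool) : ‖lam e‖ = 1 := by
  have h := congrArg (fun z : ℂ => ‖z‖) (lam_mul_self e)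
  simp only [norm_mul, norm_one] at h
  nlinarith [norm_nonneg (lam e)]

theorem liouvillePoly_eq_sum_monomial (m : ℕ) :
    liouvillePoly m = ∑ e : Fin m → Bool, monomial (ind e) (lam e) := by
  unfold liouvillePoly
  refine Finset.sum_congr rfl fun e _ => ?_
  rw [prod_ite_eq_monomial, C_mul_monomial, mul_one]

theorem coeff_liouvillePoly (m : ℕ) (d : Fin m →₀ ℕ) :
    coeff d (liouvillePoly m) = ∑ e : Fin m → Bool, if ind e = d then lam e else 0 := by
  rw [liouvillePoly_eq_sum_monomial, coeff_sum]
  refine Finset.sum_congr rfl fun e _ => ?_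
  rw [coeff_monomial]

/-- Cube coefficients: `coeff_{x^e} Λ_m = λ(1 + bin e)`. -/
theorem coeff_ind_liouvillePoly (m : ℕ) (e : Fin m → Bool) :
    coeff (ind e) (liouvillePoly m) = lam e := by
  rw [coeff_liouvillePoly]
  have : ∀ e' : Fin m → Bool, (ind e' = ind e) = (e' = e) := fun e' =>
    propext (ind_injective m).eq_iff
  simp_rw [this]
  simp

theorem coeff_liouvillePoly_eq_zero (m : ℕ) {d : Fin m →₀ ℕ} (hd : ∀ e, ind e ≠ d) :
    coeff d (liouvillePoly m) = 0 := by
  rw [coeff_liouvillePoly]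
  exact Finset.sum_eq_zero fun e _ => if_neg (hd e)

/-- The support of `Λ_m` is contained in (the image of) the cube. -/
theorem support_liouvillePoly_subset (m : ℕ) :
    (liouvillePoly m).support ⊆ Finset.univ.image (ind (m := m)) := by
  intro d hd
  rw [mem_support_iff] at hd
  by_contra h
  exact hd (coeff_liouvillePoly_eq_zero m fun e he =>
    h (Finset.mem_image.2 ⟨e, Finset.mem_univ _, he⟩))

/-- `Σ_{d ∈ supp Λ_m} ‖coeff_d Λ_m‖² ≤ 2^m`. -/
theorem sum_support_norm_sq_le (m : ℕ) :
    (∑ d ∈ (liouvillePoly m).support, ‖coeff d (liouvillePoly m)‖ ^ 2) ≤ (2 : ℝ) ^ m := by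
  calc (∑ d ∈ (liouvillePoly m).support, ‖coeff d (liouvillePoly m)‖ ^ 2)
      ≤ ∑ d ∈ Finset.univ.image (ind (m := m)), ‖coeff d (liouvillePoly m)‖ ^ 2 :=
        Finset.sum_le_sum_of_subset_of_nonneg (support_liouvillePoly_subset m)
          (fun _ _ _ => by positivity)
    _ = ∑ e : Fin m → Bool, ‖coeff (ind e) (liouvillePoly m)‖ ^ 2 := by
        rw [Finset.sum_image (fun e _ e' _ h => ind_injective m h)]
    _ = ∑ _e : Fin m → Bool, (1 : ℝ) := by
        refine Finset.sum_congr rfl fun e _ => ?_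
        rw [coeff_ind_liouvillePoly, norm_lam, one_pow]
    _ = (2 : ℝ) ^ m := by simp

/-- The λ-correlation of `Λ_m` on the cube is `2^m` (cosine 1). -/
theorem correlation_liouvillePoly (m : ℕ) :
    (∑ e : Fin m → Bool, lam e * coeff (ind e) (liouvillePoly m)) = (2 : ℂ) ^ m := by
  simp_rw [coeff_ind_liouvillePoly, lam_mul_self]
  simp

/-- `deg Λ_m ≤ m`. -/
theorem totalDegree_liouvillePoly_le (m : ℕ) : (liouvillePoly m).totalDegree ≤ m := by
  rw [liouvillePoly_eq_sum_monomial]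
  refine (totalDegree_finsetSum _ _).trans (Finset.sup_le fun e _ => ?_)
  refine (totalDegree_monomial_le _ _).trans ?_
  rw [Finsupp.sum_fintype _ _ (fun _ => rfl)]
  calc ∑ i, id (ind e i) ≤ ∑ _i : Fin m, 1 :=
        Finset.sum_le_sum fun i _ => by rw [id, ind_apply]; cases e i <;> simp
    _ = m := by simp

/-- Λ is a p-family: `n` variables and degree `≤ n` at level `n`. -/
theorem isPFamily_liouville : IsPFamily (liouvilleFamily.poly) := by
  refine ⟨⟨1, fun n => ?_⟩, ⟨1, fun n => ?_⟩⟩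
  · show Fintype.card (Fin n) ≤ n ^ 1 + 1
    simp
  · show (liouvillePoly n).totalDegree ≤ n ^ 1 + 1
    exact (totalDegree_liouvillePoly_le n).trans (by simp)

/-! ## §1 The candidate pieces -/

/-- **E1, piece 2** (routine, PROVED below): the cube-coefficient law of Λ. -/
def CubeCoefficientLaw : Prop :=
  ∀ m : ℕ, (∀ e : Fin m → Bool, coeff (ind e) (liouvillePoly m) = lam e) ∧
    (liouvillePoly m).support ⊆ Finset.univ.image (ind (m := m))

/-- **D0** (X unfolded): for every `c` some `Λ_n` has complexity `> n^c + c`. -/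
def HardIO : Prop :=
  ∀ c : ℕ, ∃ n : ℕ, n ^ c + c < complexity (liouvillePoly n)

/-- **D6a** (strengthen: almost-everywhere hardness). -/
def HardAE : Prop :=
  ∀ c : ℕ, ∃ N : ℕ, ∀ n ≥ N, n ^ c + c < complexity (liouvillePoly n)

/-- **D6b** (strengthen: quasi-polynomial hardness, Λ ∉ VQP). -/
def NotInVQP : Prop :=
  liouvilleFamily ∉ VQP ℂ

/-- **D2** (strengthen through Tavenas' chasm): ΣΠΣΠ (product-depth-2) size of Λ_n beats the
depth-reduction bound `(n+2)^{c√deg + c}` for every `c`, infinitely often. -/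
def DepthFourHard : Prop :=
  ∀ c : ℕ, ∃ n : ℕ,
    ((n + 2 : ℕ∞) ^ (c * Nat.sqrt ((liouvillePoly n).totalDegree) + c)) <
      productDepthCircuitSize 2 (liouvillePoly n)

/-- **D9a** (weak model): Λ has no polynomial-size formulas (Λ ∉ VF) — a CONSEQUENCE of X. -/
def FormulaPolyHard : Prop :=
  ¬ IsPBounded fun n => formulaComplexity (liouvillePoly n)

/-- **D9b** (the matching collapse): every VP family has p-bounded formula size (VP = VF;
disbelieved, open). -/
def VPCollapsesToVF : Prop :=
  ∀ F : PolyFamily ℂ, F ∈ VP ℂ → IsPBounded fun n => formulaComplexity (F.poly n)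

/-- **D9c** (strengthen through VSBR): the formula size of Λ is not quasi-polynomially bounded. -/
def FormulaQPHard : Prop :=
  ¬ IsQPBounded fun n => formulaComplexity (liouvillePoly n)

/-- VSBR/Hyafil as a transfer principle (known theorem, here a hypothesis): VP families have
quasi-polynomially bounded formula size. -/
def VSBRFormulas : Prop :=
  ∀ F : PolyFamily ℂ, F ∈ VP ℂ → IsQPBounded fun n => formulaComplexity (F.poly n)

/-- **D6c** (strengthen: the Kronecker–univariate form, a τ-type statement): the degree-`2^n − 1`
univariate Liouville polynomial `Σ_{k<2^n} λ(k+1) t^k` has no size-`poly(n)` circuits. -/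
def UnivariateHard : Prop :=
  ∀ c : ℕ, ∃ n : ℕ, n ^ c + c <
    complexity (∑ k ∈ Finset.range (2 ^ n),
      C ((ArithmeticFunction.liouville (k + 1) : ℤ) : ℂ) * (X (0 : Fin 1)) ^ k : MvPolynomial (Fin 1) ℂ)

/-- **D7a** (completeness split, hub piece): the permanent is not p-computable over ℂ (≡ S). -/
def PerHard : Prop :=
  ¬ IsPComputable fun n => perPoly (Fin n) ℂ

/-- **D7b** (completeness split, reduction piece): per is a p-projection of Λ (Λ is VNP-hard). -/
def PerProjectsToLiouville : Prop :=
  IsPProjection (fun n => perPoly (Fin n) ℂ) (fun n => liouvillePoly n)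

/-- Cube sequences computed by a width-`W` read-once oblivious ABP in the variable order `σ`
(Nisan 1991): `g e = uᵀ · M_{σ 0}(e_{σ 0}) ⋯ M_{σ (m−1)}(e_{σ (m−1)}) · v`. -/
def IsROABPSeq (m W : ℕ) (g : (Fin m → Bool) → ℂ) : Prop :=
  ∃ (σ : Equiv.Perm (Fin m)) (M : Fin m → Bool → Matrix (Fin W) (Fin W) ℂ) (u v : Fin W → ℂ),
    ∀ e, g e = dotProduct u (Matrix.mulVec ((List.finRange m).map fun j => M (σ j) (e (σ j))).prod v)

/-- **D10a** (transfer to the rungs, bounded width): if a size-`m^c` polynomial's cube-coefficient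
vector has cosine `≥ ε` with a target `u`, then some width-`W(c, ε)` ROABP sequence (any order) has
cosine `≥ δ(c, ε)` with `u`. -/
def CorrelationTransferBounded : Prop :=
  ∀ c : ℕ, ∀ ε : ℝ, 0 < ε → ∃ (W : ℕ) (δ : ℝ), 0 < δ ∧ ∃ m₀ : ℕ, ∀ m ≥ m₀,
    ∀ f : MvPolynomial (Fin m) ℂ, complexity f ≤ m ^ c + c → ∀ u : (Fin m → Bool) → ℂ,
      ε * ((∑ d ∈ f.support, ‖coeff d f‖ ^ 2) * ∑ e, ‖u e‖ ^ 2) ≤ ‖∑ e, u e * coeff (ind e) f‖ ^ 2 →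
      ∃ g : (Fin m → Bool) → ℂ, IsROABPSeq m W g ∧ 0 < ∑ e, ‖g e‖ ^ 2 ∧
        δ * ((∑ e, ‖g e‖ ^ 2) * ∑ e, ‖u e‖ ^ 2) ≤ ‖∑ e, u e * g e‖ ^ 2

/-- **D10b** (transfer to the rungs, polynomial width, polynomial loss). -/
def CorrelationTransferPoly : Prop :=
  ∀ c : ℕ, ∃ c' : ℕ, ∀ ε : ℝ, 0 < ε → ∃ m₀ : ℕ, ∀ m ≥ m₀,
    ∀ f : MvPolynomial (Fin m) ℂ, complexity f ≤ m ^ c + c → ∀ u : (Fin m → Bool) → ℂ,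
      ε * ((∑ d ∈ f.support, ‖coeff d f‖ ^ 2) * ∑ e, ‖u e‖ ^ 2) ≤ ‖∑ e, u e * coeff (ind e) f‖ ^ 2 →
      ∃ g : (Fin m → Bool) → ℂ, IsROABPSeq m (m ^ c' + c') g ∧ 0 < ∑ e, ‖g e‖ ^ 2 ∧
        ((∑ e, ‖g e‖ ^ 2) * ∑ e, ‖u e‖ ^ 2) ≤ (m ^ c' + c' : ℝ) * ‖∑ e, u e * g e‖ ^ 2

/-- **D10c / D11** (the arithmetic half, a RATE form of the route's rungs): λ on the cube is
`m^{-A}`-orthogonal to width-`m^c` ROABP sequences in every order. -/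
def LiouvilleOrthogonalROABP : Prop :=
  ∀ c A : ℕ, ∃ m₀ : ℕ, ∀ m ≥ m₀, ∀ g : (Fin m → Bool) → ℂ, IsROABPSeq m (m ^ c + c) g →
    (m : ℝ) ^ A * ‖∑ e, lam e * g e‖ ^ 2 ≤ 2 ^ m * ∑ e, ‖g e‖ ^ 2

/-- **D12a** (un-tailored inverse theorem, "VP-correlation forces pretentiousness"): a 1-bounded
completely multiplicative `g` whose values along `k = 1 + bin e` correlate at a fixed rate with the
cube coefficients of size-`m^c` polynomials for infinitely many `m` is pretentious. -/
def VPCorrelationImpliesPretentious : Prop :=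
  ∀ g : ℕ → ℂ, (∀ n, ‖g n‖ ≤ 1) → (∀ a b, g (a * b) = g a * g b) →
    ∀ c : ℕ, ∀ ε : ℝ, 0 < ε →
      (∀ m₀ : ℕ, ∃ m ≥ m₀, ∃ f : MvPolynomial (Fin m) ℂ, complexity f ≤ m ^ c + c ∧
        ε * 2 ^ m * (∑ d ∈ f.support, ‖coeff d f‖ ^ 2) <
          ‖∑ e : Fin m → Bool, g (Nat.ofBits e + 1) * coeff (ind e) f‖ ^ 2) →
      ¬ Literature.NumberTheory.Sieve.IsNonpretentious g

/-- **D12b** (the Λ-side piece): λ is non-pretentious — PROVED in the tree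
(`Literature.NumberTheory.LFunctions.isNonpretentious_liouville_holds`). -/
def LiouvilleNonpretentious : Prop :=
  Literature.NumberTheory.Sieve.isNonpretentious_liouville

/-! ## §2 Demos -/

/-- E1 piece 2 is a theorem (routine bookkeeping). -/
theorem cubeCoefficientLaw_holds : CubeCoefficientLaw :=
  fun m => ⟨coeff_ind_liouvillePoly m, support_liouvillePoly_subset m⟩

/-- Under `AlgebraicSarnak` the complexity of `Λ_m` is not p-bounded (the E1 assembly body). -/
theorem exists_complexity_liouvillePoly_gt (hAS : AlgebraicSarnak) (c : ℕ) :
    ∃ m : ℕ, m ^ c + c < complexity (liouvillePoly m) := by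
  by_contra hcon
  push Not at hcon
  obtain ⟨m₀, hm₀⟩ := hAS c (1 / 2) (by norm_num)
  have h := hm₀ m₀ le_rfl (liouvillePoly m₀) (hcon m₀)
  have hL : ‖∑ e : Fin m₀ → Bool, lam e * coeff (ind e) (liouvillePoly m₀)‖ ^ 2
      = (4 : ℝ) ^ m₀ := by
    rw [correlation_liouvillePoly, norm_pow, Complex.norm_ofNat, ← pow_mul,
      show (2 : ℝ) ^ (m₀ * 2) = 4 ^ m₀ by rw [mul_comm, pow_mul]; norm_num]
  have hR : (1 / 2 : ℝ) * 2 ^ m₀ * ∑ d ∈ (liouvillePoly m₀).support,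
      ‖coeff d (liouvillePoly m₀)‖ ^ 2 ≤ (1 / 2) * 4 ^ m₀ := by
    calc (1 / 2 : ℝ) * 2 ^ m₀ * ∑ d ∈ (liouvillePoly m₀).support, ‖coeff d (liouvillePoly m₀)‖ ^ 2
        ≤ (1 / 2 : ℝ) * 2 ^ m₀ * 2 ^ m₀ := by
          gcongr
          exact sum_support_norm_sq_le m₀
      _ = (1 / 2) * 4 ^ m₀ := by
          rw [mul_assoc, ← mul_pow]; norm_num
  have h4 : (0 : ℝ) < 4 ^ m₀ := by positivity
  have h' : (4 : ℝ) ^ m₀ ≤ (1 / 2) * 4 ^ m₀ := by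
    calc (4 : ℝ) ^ m₀ = ‖∑ e : Fin m₀ → Bool, lam e * coeff (ind e) (liouvillePoly m₀)‖ ^ 2 :=
          hL.symm
      _ ≤ _ := h
      _ ≤ _ := hR
  linarith

/-- **E1 is a strengthening, not a split:** the engine alone gives X
(= the support item `SarnakImpliesHard`, here sorry-free). -/
theorem X_of_algebraicSarnak (hAS : AlgebraicSarnak) : LiouvilleNotInVP := by
  intro hVP
  obtain ⟨c, hc⟩ := hVP.2
  obtain ⟨m, hm⟩ := exists_complexity_liouvillePoly_gt hAS c
  exact absurd (hc m) (not_le.2 hm)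

theorem sarnakImpliesHard_holds : SarnakImpliesHard := X_of_algebraicSarnak

/-- **D0: X is exactly "the complexity of Λ is not p-bounded"** (Λ being a p-family). -/
theorem hardIO_iff_X : HardIO ↔ LiouvilleNotInVP := by
  constructor
  · intro h hVP
    obtain ⟨c, hc⟩ := hVP.2
    obtain ⟨n, hn⟩ := h c
    exact absurd (hc n) (not_le.2 hn)
  · intro hX c
    by_contra h
    push Not at h
    exact hX ⟨isPFamily_liouville, ⟨c, h⟩⟩

/-- **D6a ≥ X** in three lines. -/
theorem X_of_hardAE (h : HardAE) : LiouvilleNotInVP :=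
  hardIO_iff_X.1 fun c => let ⟨N, hN⟩ := h c; ⟨N, hN N le_rfl⟩

/-- **D6b ≥ X**: `VP ⊆ VQP`. -/
theorem X_of_notInVQP (h : NotInVQP) : LiouvilleNotInVP :=
  fun hVP => h (VP_subset_VQP_holds ℂ hVP)

/-- **D2 ≥ X** given Tavenas' depth reduction (a named Literature fact): five lines. -/
theorem X_of_depthFourHard (hT : productDepthCircuitSize_two_le_of_isVPFamily)
    (h : DepthFourHard) : LiouvilleNotInVP := by
  intro hVP
  obtain ⟨c, hc⟩ := hT (fun n => liouvillePoly n) hVP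
  obtain ⟨n, hn⟩ := h c
  exact absurd (hc n) (not_le.2 hn)

/-- **D9c ≥ X** given VSBR (formulas of quasi-polynomial size for VP): two lines. -/
theorem X_of_formulaQPHard_of_vsbr (hV : VSBRFormulas) (h : FormulaQPHard) : LiouvilleNotInVP :=
  fun hVP => h (hV _ hVP)

/-- **D9a ∧ D9b → X is a one-line seam** (and D9b is a disbelieved collapse). -/
theorem X_of_collapse (h₁ : VPCollapsesToVF) (h₂ : FormulaPolyHard) : LiouvilleNotInVP :=
  fun hVP => h₂ (h₁ _ hVP)

/-- **D7a ≡ S**: the hub piece is the summit by a LANDED iff. -/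
theorem perHard_iff_S : PerHard ↔ _root_.ValiantsHypothesis :=
  perNotPComputableComplex_iff_holds

/-- **D7a ∧ D7b → X is a one-line seam** (closure of p-computability under p-projection). -/
theorem X_of_perHard_of_proj (h₁ : PerHard) (h₂ : PerProjectsToLiouville) : LiouvilleNotInVP :=
  fun hVP => h₁ (IsPComputable.of_isPProjection_holds h₂ hVP.2)

/-- λ as a complex-valued function is 1-bounded. -/
theorem norm_liouville_le_one (n : ℕ) : ‖((ArithmeticFunction.liouville n : ℤ) : ℂ)‖ ≤ 1 := by
  rcases eq_or_ne n 0 with rfl | hn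
  · simp
  · rw [ArithmeticFunction.liouville_apply hn]
    simp

/-- λ as a complex-valued function is completely multiplicative (with `λ 0 = 0`). -/
theorem liouville_mul_cast (a b : ℕ) :
    (((ArithmeticFunction.liouville (a * b) : ℤ) : ℂ)) =
      ((ArithmeticFunction.liouville a : ℤ) : ℂ) * ((ArithmeticFunction.liouville b : ℤ) : ℂ) := by
  rcases eq_or_ne a 0 with rfl | ha
  · simp
  rcases eq_or_ne b 0 with rfl | hb
  · simp
  rw [← Int.cast_mul, ArithmeticFunction.liouville_apply (mul_ne_zero ha hb),
    ArithmeticFunction.liouville_apply ha, ArithmeticFunction.liouville_apply hb,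
    ArithmeticFunction.cardFactors_mul ha hb, pow_add]

/-- **D12 is a strengthening of the ENGINE**: the un-tailored inverse theorem together with the
PROVED non-pretentiousness of λ already yields `AlgebraicSarnak` (hence X). -/
theorem algebraicSarnak_of_pretentiousTransfer (h₁ : VPCorrelationImpliesPretentious)
    (h₂ : LiouvilleNonpretentious) : AlgebraicSarnak := by
  by_contra hAS
  unfold AlgebraicSarnak at hAS
  push Not at hAS
  obtain ⟨c, ε, hε, hbad⟩ := hAS
  refine h₁ (fun n => ((ArithmeticFunction.liouville n : ℤ) : ℂ)) norm_liouville_le_one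
    liouville_mul_cast c ε hε (fun m₀ => ?_) h₂
  obtain ⟨m, hm, f, hf, hlt⟩ := hbad m₀
  exact ⟨m, hm, f, hf, hlt⟩

/-- Hence the D12 split already proves X outright from its single open piece. -/
theorem X_of_pretentiousTransfer (h₁ : VPCorrelationImpliesPretentious) : LiouvilleNotInVP :=
  X_of_algebraicSarnak (algebraicSarnak_of_pretentiousTransfer h₁
    Literature.NumberTheory.LFunctions.isNonpretentious_liouville_holds)

end Summit.ValiantsHypothesis.ValiantsHypothesis.Cruxes.LiouvilleNotInVP.Census
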